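import Mathlib
import HarnessLib

/-!
# Route `IntegerScrew` — a weak unconditional Poincaré inequality for the truncated multiplicative walk

The first LOWER bound (in the kernel) for the spectral gap of the truncated multiplicative walk of PROP. N4
(`IntegerScrewWalkGenerator` / `IntegerScrewWalkDirichlet`).  With the harmonic weights `1/x` on `{1,…,M}` and
the smallest-prime death `x → x / minFac x` (rate `Λ(minFac x) = log minFac x`), for every `g : ℕ → ℝ`:

* `sq_sub_le_cardFactors_mul_sum_divisors` — telescoping along the smallest-prime path:
  `(g x − g 1)² ≤ Ω(x) · Σ_{y ∣ x, y ≥ 2} (g y − g(y / minFac y))²` (Cauchy–Schwarz, by strong induction);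
* `cardFactors_le_log_two` — `Ω(x) ≤ log₂ x`;
* `sum_inv_filter_dvd_le` — `Σ_{x ≤ M, y ∣ x} 1/x ≤ (1 + log M)/y`;
* **`walk_poincare_weak`** —
  `Σ_{x ≤ M} (1/x)(g x − g 1)² ≤ ⌊log₂ M⌋ (1 + log M) · Σ_{2 ≤ y ≤ M} (1/y)(g y − g(y/minFac y))²`;
* **`walk_poincare_weak_dirichlet`** — the right-hand side is `≤ (⌊log₂M⌋(1 + log M)/log 2) · D(g)` with
  `D(g) = Σ_{x ≤ M} (1/x) Σ_{n ∣ x} Λ(n)(g x − g(x/n))²` the (t-time, unnormalised) Dirichlet form of the walk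
  (`dirichlet_eq_half_sum_sq` of `IntegerScrewWalkDirichlet` identifies `D(g)/(H_M·L)` with the τ-form `E(g)`).

Since the π-variance is at most the second moment about `g 1`, this says: every non-zero eigenvalue of `−ℒ_M`
is `≥ log 2/(⌊log₂ M⌋(1 + log M))` in t-units — a `1/L²` lower bound, against the `O(1)` upper skeleton of the
prime-parity ladder (`IntegerScrewWalkGap` …) and the conjectured truth `2 log 2 − O(1/L)` (CONTINUUM-LIMIT §24,
which replaces the factor `1 + log M` by the Mertens constant `2/log 2` on paper, PROP. 24.7).  RH-free, elementary.

References: PIVOT-LAW §13.10, CONTINUUM-LIMIT §23.18/§24 (rh-explicit A6-PIVOT); M. Suzuki, J. Lond. Math. Soc. (2)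
108 (2023) 1448–1487 [Suzuki2023].
-/

noncomputable section

set_option linter.dupNamespace false -- D-0017: `Summit.<S>.<S>.…` is the designed namespace

namespace Summit.RiemannHypothesis.RiemannHypothesis.Theorems.IntegerScrew

open Finset ArithmeticFunction
open scoped ArithmeticFunction.Omega

/-! ### The smallest-prime step -/

/-- `Ω(x) = Ω(x / minFac x) + 1` for `x ≥ 2`. -/
theorem cardFactors_div_minFac {x : ℕ} (hx : 2 ≤ x) : Ω (x / x.minFac) + 1 = Ω x := by
  obtain ⟨n, rfl⟩ : ∃ n, x = n + 2 := ⟨x - 2, by omega⟩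
  rw [cardFactors_apply, cardFactors_apply, Nat.primeFactorsList_add_two, List.length_cons]

/-- `x / minFac x < x` for `x ≥ 2`. -/
theorem div_minFac_lt {x : ℕ} (hx : 2 ≤ x) : x / x.minFac < x :=
  Nat.div_lt_self (by omega) (Nat.minFac_prime (by omega)).one_lt

/-- `1 ≤ x / minFac x` for `x ≥ 1`. -/
theorem one_le_div_minFac {x : ℕ} (hx : 1 ≤ x) : 1 ≤ x / x.minFac :=
  Nat.div_pos (Nat.minFac_le (by omega)) (Nat.minFac_pos x)

/-- `Ω(x) ≤ log₂ x`: `2^{Ω(x)} ≤ x` for `x ≥ 1`. -/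
theorem two_pow_cardFactors_le {x : ℕ} (hx : 1 ≤ x) : 2 ^ Ω x ≤ x := by
  induction x using Nat.strong_induction_on with
  | _ x ih =>
    rcases lt_or_ge x 2 with h | h
    · have : x = 1 := by omega
      subst this; simp
    · have hlt := div_minFac_lt h
      have h1 : 1 ≤ x / x.minFac := one_le_div_minFac hx
      have := ih _ hlt h1
      rw [← cardFactors_div_minFac h, pow_succ]
      calc 2 ^ Ω (x / x.minFac) * 2 ≤ (x / x.minFac) * x.minFac :=
            Nat.mul_le_mul this (Nat.minFac_prime (by omega)).two_le
        _ = x := Nat.div_mul_cancel (Nat.minFac_dvd x)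

/-- `Ω(x) ≤ ⌊log₂ x⌋`. -/
theorem cardFactors_le_log_two {x : ℕ} (hx : 1 ≤ x) : Ω x ≤ Nat.log 2 x :=
  Nat.le_log_of_pow_le (by norm_num) (two_pow_cardFactors_le hx)

/-! ### Telescoping along the smallest-prime path -/

/-- **Telescoping + Cauchy–Schwarz along the smallest-prime path.**  For `x ≥ 1`:
`(g x − g 1)² ≤ Ω(x) · Σ_{y ∣ x, y ≥ 2} (g y − g(y / minFac y))²`. -/
theorem sq_sub_le_cardFactors_mul_sum_divisors (g : ℕ → ℝ) {x : ℕ} (hx : 1 ≤ x) :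
    (g x - g 1) ^ 2 ≤
      (Ω x : ℝ) * ∑ y ∈ x.divisors with 2 ≤ y, (g y - g (y / y.minFac)) ^ 2 := by
  induction x using Nat.strong_induction_on with
  | _ x ih =>
    rcases lt_or_ge x 2 with h | h
    · have : x = 1 := by omega
      subst this; simp
    · -- x ≥ 2: x' = x / minFac x
      set x' := x / x.minFac with hx'
      have hlt : x' < x := div_minFac_lt h
      have h1 : 1 ≤ x' := one_le_div_minFac hx
      have hx0 : x ≠ 0 := by omega
      have hΩ : (Ω x : ℝ) = Ω x' + 1 := by
        rw [← cardFactors_div_minFac h]; push_cast; rfl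
      set S' := ∑ y ∈ x'.divisors with 2 ≤ y, (g y - g (y / y.minFac)) ^ 2 with hS'
      set S := ∑ y ∈ x.divisors with 2 ≤ y, (g y - g (y / y.minFac)) ^ 2 with hS
      have hIH : (g x' - g 1) ^ 2 ≤ (Ω x' : ℝ) * S' := ih x' hlt h1
      have hS'nn : 0 ≤ S' := Finset.sum_nonneg fun y _ => sq_nonneg _
      -- `e(x) + S' ≤ S`: the divisors `≥ 2` of `x'` together with `x` itself are divisors `≥ 2` of `x`
      have hsub : insert x (x'.divisors.filter (fun y => 2 ≤ y)) ⊆ x.divisors.filter (fun y => 2 ≤ y) := by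
        intro y hy
        rcases Finset.mem_insert.1 hy with rfl | hy
        · exact mem_filter.2 ⟨Nat.mem_divisors_self _ hx0, h⟩
        · obtain ⟨hyd, hy2⟩ := mem_filter.1 hy
          refine mem_filter.2 ⟨Nat.mem_divisors.2 ⟨?_, hx0⟩, hy2⟩
          exact (Nat.mem_divisors.1 hyd).1.trans (Nat.div_dvd_of_dvd (Nat.minFac_dvd x))
      have hnot : x ∉ x'.divisors.filter (fun y => 2 ≤ y) := by
        intro hm
        have := Nat.divisor_le (mem_filter.1 hm).1
        omega
      have hstep : (g x - g x') ^ 2 + S' ≤ S := by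
        have := Finset.sum_le_sum_of_subset_of_nonneg hsub
          (f := fun y => (g y - g (y / y.minFac)) ^ 2) (fun y _ _ => sq_nonneg _)
        rwa [Finset.sum_insert hnot] at this
      -- Cauchy–Schwarz: (a + b)² ≤ (1 + n) a² + (1 + 1/n) b²
      have key : (g x - g 1) ^ 2 ≤ ((Ω x' : ℝ) + 1) * ((g x - g x') ^ 2 + S') := by
        have hn : (0 : ℝ) ≤ Ω x' := Nat.cast_nonneg _
        rcases eq_or_lt_of_le hn with h0 | hpos
        · -- Ω x' = 0: x' = 1
          have hΩ0 : Ω x' = 0 := by exact_mod_cast h0.symm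
          have hx'1 : x' = 1 := by
            rcases cardFactors_eq_zero_iff_eq_zero_or_one.1 hΩ0 with h' | h' <;> omega
          have hb0 : g x' - g 1 = 0 := by rw [hx'1, sub_self]
          have hsplit : g x - g 1 = (g x - g x') + (g x' - g 1) := by ring
          rw [hsplit, hb0, add_zero, ← h0, zero_add, one_mul]
          linarith [hS'nn]
        · -- (a+b)² ≤ (1+n)a² + (1+1/n)b², with b² ≤ n S'
          set n : ℝ := (Ω x' : ℝ) with hn'
          set a : ℝ := g x - g x'
          set b : ℝ := g x' - g 1
          have hab : g x - g 1 = a + b := by ring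
          have hb : b ^ 2 ≤ n * S' := hIH
          have hcs : (a + b) ^ 2 ≤ (1 + n) * a ^ 2 + (1 + 1 / n) * b ^ 2 := by
            have h' : 0 ≤ (n * a - b) ^ 2 / n := div_nonneg (sq_nonneg _) hpos.le
            have hexp : (1 + n) * a ^ 2 + (1 + 1 / n) * b ^ 2 - (a + b) ^ 2 = (n * a - b) ^ 2 / n := by
              field_simp; ring
            linarith
          have h2 : (1 + 1 / n) * b ^ 2 ≤ (1 + 1 / n) * (n * S') :=
            mul_le_mul_of_nonneg_left hb (by positivity)
          have h3 : (1 + 1 / n) * (n * S') = (n + 1) * S' := by field_simp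
          rw [hab]
          nlinarith [hcs, h2, h3, sq_nonneg a]
      calc (g x - g 1) ^ 2 ≤ ((Ω x' : ℝ) + 1) * ((g x - g x') ^ 2 + S') := key
        _ ≤ ((Ω x' : ℝ) + 1) * S := mul_le_mul_of_nonneg_left hstep (by positivity)
        _ = (Ω x : ℝ) * S := by rw [hΩ]

/-! ### Harmonic mass of multiples -/

/-- `Σ_{j ≤ M, k ∣ j} G(j) = Σ_{n ≤ M/k} G(kn)` (adapted from `IntegerScrewParityGap.sum_Icc_filter_dvd_eq`). -/
theorem sum_Icc_filter_dvd_eq_mul {M k : ℕ} (hk : 1 ≤ k) (G : ℕ → ℝ) :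
    ∑ j ∈ (Icc 1 M).filter (fun j => k ∣ j), G j = ∑ n ∈ Icc 1 (M / k), G (k * n) := by
  have hk0 : k ≠ 0 := by omega
  have hset : (Icc 1 M).filter (fun j => k ∣ j) =
      (Icc 1 (M / k)).map ⟨fun n => k * n, mul_right_injective₀ hk0⟩ := by
    ext j
    simp only [mem_filter, mem_Icc, mem_map, Function.Embedding.coeFn_mk]
    constructor
    · rintro ⟨⟨h1, h2⟩, ⟨n, rfl⟩⟩
      refine ⟨n, ⟨?_, ?_⟩, rfl⟩
      · rcases Nat.eq_zero_or_pos n with h | h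
        · subst h; simp at h1
        · exact h
      · exact (Nat.le_div_iff_mul_le hk).2 (by rw [mul_comm]; exact h2)
    · rintro ⟨n, ⟨h1, h2⟩, rfl⟩
      refine ⟨⟨?_, ?_⟩, dvd_mul_right k n⟩
      · exact Nat.one_le_iff_ne_zero.2 (Nat.mul_ne_zero hk0 (by omega))
      · have := (Nat.le_div_iff_mul_le hk).1 h2
        rwa [mul_comm] at this
  rw [hset, sum_map]
  rfl

/-- **`Σ_{x ≤ M, y ∣ x} 1/x ≤ (1 + log M)/y`** (`y ≥ 1`). -/
theorem sum_inv_filter_dvd_le {M y : ℕ} (hy : 1 ≤ y) :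
    ∑ x ∈ (Icc 1 M).filter (fun x => y ∣ x), (1 : ℝ) / x ≤ (1 + Real.log M) / y := by
  rw [sum_Icc_filter_dvd_eq_mul hy]
  have hy0 : (0 : ℝ) < y := by exact_mod_cast hy
  have hH : ∑ n ∈ Icc 1 (M / y), (1 : ℝ) / ((y * n : ℕ) : ℝ) = (1 / y) * ∑ n ∈ Icc 1 (M / y), (1 : ℝ) / n := by
    rw [Finset.mul_sum]
    refine Finset.sum_congr rfl fun n _ => ?_
    push_cast
    rw [one_div_mul_one_div]
  rw [hH]
  -- harmonic bound: Σ_{n ≤ M/y} 1/n ≤ Σ_{n ≤ M} 1/n = H_M ≤ 1 + log M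
  have hmono : ∑ n ∈ Icc 1 (M / y), (1 : ℝ) / n ≤ ∑ n ∈ Icc 1 M, (1 : ℝ) / n :=
    Finset.sum_le_sum_of_subset_of_nonneg (Finset.Icc_subset_Icc_right (Nat.div_le_self M y))
      (fun n _ _ => by positivity)
  have hharm : ∑ n ∈ Icc 1 M, (1 : ℝ) / n ≤ 1 + Real.log M := by
    have h := harmonic_le_one_add_log M
    rw [harmonic_eq_sum_Icc] at h
    push_cast at h
    simpa [one_div] using h
  calc (1 / (y : ℝ)) * ∑ n ∈ Icc 1 (M / y), (1 : ℝ) / n ≤ (1 / y) * (1 + Real.log M) :=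
        mul_le_mul_of_nonneg_left (hmono.trans hharm) (by positivity)
    _ = (1 + Real.log M) / y := by ring

/-! ### The weak Poincaré inequality -/

/-- **Weak Poincaré inequality for the truncated multiplicative walk.**  For every `M ≥ 1` and `g`:
`Σ_{x ≤ M} (1/x)(g x − g 1)² ≤ ⌊log₂M⌋·(1 + log M) · Σ_{2 ≤ y ≤ M} (1/y)(g y − g(y/minFac y))²`. -/
theorem walk_poincare_weak (M : ℕ) (g : ℕ → ℝ) :
    ∑ x ∈ Icc 1 M, (1 / (x : ℝ)) * (g x - g 1) ^ 2 ≤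
      (Nat.log 2 M : ℝ) * (1 + Real.log M) *
        ∑ y ∈ Icc 2 M, (1 / (y : ℝ)) * (g y - g (y / y.minFac)) ^ 2 := by
  set e : ℕ → ℝ := fun y => (g y - g (y / y.minFac)) ^ 2 with he
  have he0 : ∀ y, 0 ≤ e y := fun y => sq_nonneg _
  -- Step 1: pointwise telescoping and Ω ≤ log₂ M
  have h1 : ∑ x ∈ Icc 1 M, (1 / (x : ℝ)) * (g x - g 1) ^ 2 ≤
      ∑ x ∈ Icc 1 M, (Nat.log 2 M : ℝ) * ((1 / (x : ℝ)) * ∑ y ∈ x.divisors with 2 ≤ y, e y) := by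
    refine Finset.sum_le_sum fun x hx => ?_
    have hx1 : 1 ≤ x := (mem_Icc.1 hx).1
    have hΩ : (Ω x : ℝ) ≤ Nat.log 2 M := by
      exact_mod_cast (cardFactors_le_log_two hx1).trans (Nat.log_mono_right (mem_Icc.1 hx).2)
    have hSnn : 0 ≤ ∑ y ∈ x.divisors with 2 ≤ y, e y := Finset.sum_nonneg fun y _ => he0 y
    calc (1 / (x : ℝ)) * (g x - g 1) ^ 2 ≤ (1 / (x : ℝ)) * ((Ω x : ℝ) * ∑ y ∈ x.divisors with 2 ≤ y, e y) :=
          mul_le_mul_of_nonneg_left (sq_sub_le_cardFactors_mul_sum_divisors g hx1) (by positivity)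
      _ ≤ (1 / (x : ℝ)) * ((Nat.log 2 M : ℝ) * ∑ y ∈ x.divisors with 2 ≤ y, e y) :=
          mul_le_mul_of_nonneg_left (mul_le_mul_of_nonneg_right hΩ hSnn) (by positivity)
      _ = _ := by ring
  -- Step 2: exchange the sums
  have hcomm : ∑ x ∈ Icc 1 M, ((1 / (x : ℝ)) * ∑ y ∈ x.divisors with 2 ≤ y, e y) =
      ∑ y ∈ Icc 2 M, e y * ∑ x ∈ (Icc 1 M).filter (fun x => y ∣ x), (1 / (x : ℝ)) := by
    simp_rw [Finset.mul_sum]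
    refine (Finset.sum_comm' (s := Icc 1 M) (t := fun x => x.divisors.filter (fun y => 2 ≤ y))
      (t' := Icc 2 M) (s' := fun y => (Icc 1 M).filter (fun x => y ∣ x))
      (f := fun x y => (1 / (x : ℝ)) * e y) ?_).trans ?_
    · intro x y
      simp only [mem_Icc, mem_filter, Nat.mem_divisors]
      constructor
      · rintro ⟨⟨hx1, hxM⟩, ⟨hyx, hx0⟩, hy2⟩
        exact ⟨⟨⟨hx1, hxM⟩, hyx⟩, hy2, (Nat.le_of_dvd (by omega) hyx).trans hxM⟩
      · rintro ⟨⟨⟨hx1, hxM⟩, hyx⟩, hy2, hyM⟩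
        exact ⟨⟨hx1, hxM⟩, ⟨hyx, by omega⟩, hy2⟩
    · -- pointwise: (1/x) * e y = e y * (1/x)
      exact Finset.sum_congr rfl fun y _ => Finset.sum_congr rfl fun x _ => mul_comm _ _
  -- Step 3: harmonic mass of the multiples of y
  have h3 : ∑ y ∈ Icc 2 M, e y * ∑ x ∈ (Icc 1 M).filter (fun x => y ∣ x), (1 / (x : ℝ)) ≤
      ∑ y ∈ Icc 2 M, e y * ((1 + Real.log M) / y) := by
    refine Finset.sum_le_sum fun y hy => mul_le_mul_of_nonneg_left ?_ (he0 y)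
    exact sum_inv_filter_dvd_le (by have := (mem_Icc.1 hy).1; omega)
  have hlogM : 0 ≤ 1 + Real.log M := by
    have : 0 ≤ Real.log M := Real.log_natCast_nonneg M
    linarith
  calc ∑ x ∈ Icc 1 M, (1 / (x : ℝ)) * (g x - g 1) ^ 2
      ≤ ∑ x ∈ Icc 1 M, (Nat.log 2 M : ℝ) * ((1 / (x : ℝ)) * ∑ y ∈ x.divisors with 2 ≤ y, e y) := h1
    _ = (Nat.log 2 M : ℝ) * ∑ y ∈ Icc 2 M, e y * ∑ x ∈ (Icc 1 M).filter (fun x => y ∣ x), (1 / (x : ℝ)) := by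
        rw [← Finset.mul_sum, hcomm]
    _ ≤ (Nat.log 2 M : ℝ) * ∑ y ∈ Icc 2 M, e y * ((1 + Real.log M) / y) :=
        mul_le_mul_of_nonneg_left h3 (Nat.cast_nonneg _)
    _ = (Nat.log 2 M : ℝ) * (1 + Real.log M) * ∑ y ∈ Icc 2 M, (1 / (y : ℝ)) * (g y - g (y / y.minFac)) ^ 2 := by
        have hre : ∑ y ∈ Icc 2 M, e y * ((1 + Real.log M) / y) =
            (1 + Real.log M) * ∑ y ∈ Icc 2 M, (1 / (y : ℝ)) * (g y - g (y / y.minFac)) ^ 2 := by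
          rw [Finset.mul_sum]
          refine Finset.sum_congr rfl fun y _ => ?_
          simp only [he]
          ring
        rw [hre]
        ring

/-- The smallest-prime deaths are part of the Dirichlet form: for `2 ≤ y`,
`(1/y)·log(minFac y)·(g y − g(y/minFac y))² ≤ (1/y)·Σ_{n ∣ y} Λ(n)(g y − g(y/n))²`. -/
theorem minFac_term_le_dirichlet_term (g : ℕ → ℝ) {y : ℕ} (hy : 2 ≤ y) :
    (1 / (y : ℝ)) * (Real.log y.minFac * (g y - g (y / y.minFac)) ^ 2) ≤
      (1 / (y : ℝ)) * ∑ n ∈ y.divisors, (Λ n : ℝ) * (g y - g (y / n)) ^ 2 := by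
  refine mul_le_mul_of_nonneg_left ?_ (by positivity)
  have hp : y.minFac.Prime := Nat.minFac_prime (by omega)
  have hmem : y.minFac ∈ y.divisors := Nat.mem_divisors.2 ⟨Nat.minFac_dvd y, by omega⟩
  have hΛ : (Λ y.minFac : ℝ) = Real.log y.minFac := by
    rw [vonMangoldt_apply_prime hp]
  calc Real.log y.minFac * (g y - g (y / y.minFac)) ^ 2
      = (Λ y.minFac : ℝ) * (g y - g (y / y.minFac)) ^ 2 := by rw [hΛ]
    _ ≤ ∑ n ∈ y.divisors, (Λ n : ℝ) * (g y - g (y / n)) ^ 2 :=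
        Finset.single_le_sum (f := fun n => (Λ n : ℝ) * (g y - g (y / n)) ^ 2)
          (fun n _ => mul_nonneg vonMangoldt_nonneg (sq_nonneg _)) hmem

/-- **Weak Poincaré inequality, Dirichlet-form version.**  With
`D(g) = Σ_{x ≤ M} (1/x) Σ_{n ∣ x} Λ(n)(g x − g(x/n))²` (the unnormalised t-time Dirichlet form of the walk):
`log 2 · Σ_{x ≤ M} (1/x)(g x − g 1)² ≤ ⌊log₂M⌋ (1 + log M) · D(g)`.  Hence (the π-variance being at most the
second moment about `g 1`) every non-zero eigenvalue of `−ℒ_M` is `≥ log 2/(⌊log₂M⌋(1 + log M))` in t-units. -/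
theorem walk_poincare_weak_dirichlet (M : ℕ) (g : ℕ → ℝ) :
    Real.log 2 * ∑ x ∈ Icc 1 M, (1 / (x : ℝ)) * (g x - g 1) ^ 2 ≤
      (Nat.log 2 M : ℝ) * (1 + Real.log M) *
        ∑ x ∈ Icc 1 M, (1 / (x : ℝ)) * ∑ n ∈ x.divisors, (Λ n : ℝ) * (g x - g (x / n)) ^ 2 := by
  have hlog2 : 0 < Real.log 2 := Real.log_pos (by norm_num)
  have hlogM : 0 ≤ 1 + Real.log M := by
    have : 0 ≤ Real.log M := Real.log_natCast_nonneg M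
    linarith
  have hcoef : 0 ≤ (Nat.log 2 M : ℝ) * (1 + Real.log M) := mul_nonneg (Nat.cast_nonneg _) hlogM
  -- log 2 · (tree form) ≤ (tree form with log minFac) ≤ D(g) restricted to y ≥ 2 ≤ D(g)
  have htree : Real.log 2 * ∑ y ∈ Icc 2 M, (1 / (y : ℝ)) * (g y - g (y / y.minFac)) ^ 2 ≤
      ∑ x ∈ Icc 1 M, (1 / (x : ℝ)) * ∑ n ∈ x.divisors, (Λ n : ℝ) * (g x - g (x / n)) ^ 2 := by
    rw [Finset.mul_sum]
    have hsub : Icc 2 M ⊆ Icc 1 M := Finset.Icc_subset_Icc_left (by norm_num)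
    refine le_trans (Finset.sum_le_sum fun y hy => ?_)
      (Finset.sum_le_sum_of_subset_of_nonneg hsub fun x _ _ =>
        mul_nonneg (by positivity) (Finset.sum_nonneg fun n _ => mul_nonneg vonMangoldt_nonneg (sq_nonneg _)))
    have hy2 : 2 ≤ y := (mem_Icc.1 hy).1
    have hmf : Real.log 2 ≤ Real.log y.minFac :=
      Real.log_le_log (by norm_num) (by exact_mod_cast (Nat.minFac_prime (by omega)).two_le)
    calc Real.log 2 * ((1 / (y : ℝ)) * (g y - g (y / y.minFac)) ^ 2)
        = (1 / (y : ℝ)) * (Real.log 2 * (g y - g (y / y.minFac)) ^ 2) := by ring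
      _ ≤ (1 / (y : ℝ)) * (Real.log y.minFac * (g y - g (y / y.minFac)) ^ 2) :=
          mul_le_mul_of_nonneg_left (mul_le_mul_of_nonneg_right hmf (sq_nonneg _)) (by positivity)
      _ ≤ (1 / (y : ℝ)) * ∑ n ∈ y.divisors, (Λ n : ℝ) * (g y - g (y / n)) ^ 2 :=
          minFac_term_le_dirichlet_term g hy2
  calc Real.log 2 * ∑ x ∈ Icc 1 M, (1 / (x : ℝ)) * (g x - g 1) ^ 2
      ≤ Real.log 2 * ((Nat.log 2 M : ℝ) * (1 + Real.log M) *
          ∑ y ∈ Icc 2 M, (1 / (y : ℝ)) * (g y - g (y / y.minFac)) ^ 2) :=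
        mul_le_mul_of_nonneg_left (walk_poincare_weak M g) hlog2.le
    _ = (Nat.log 2 M : ℝ) * (1 + Real.log M) *
          (Real.log 2 * ∑ y ∈ Icc 2 M, (1 / (y : ℝ)) * (g y - g (y / y.minFac)) ^ 2) := by ring
    _ ≤ _ := mul_le_mul_of_nonneg_left htree hcoef

end Summit.RiemannHypothesis.RiemannHypothesis.Theorems.IntegerScrew

end
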